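import Summits.ResolutionOfSingularities.ResolutionOfSingularities.Theorems.FrobeniusClosingPatchingRelPerfectCrossingLinesTowerCharts
import HarnessLib

/-!
# Crux `PatchingRelPerfect` (stmt-ResolutionOfSingularities-16161), chain W5.2 — the CROSSING-LINES
# member `I = (x₀x₁ + x₂x₃, x₃²) + 𝔪⁴`, part 4: the charts of `x₀` and `x₁` (conic tower with
# the avatars of the absent centres)

[OURS · L1 W5.2 · kernel certificate, res-L1-w52-plan-1 NAMING 2026-08-27T17:00:47Z (O2′)]
The global companion of the crossing-lines member is `Q = P₁ P₂ P₃ P₄ · 𝔪` with the S-avatars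
`P₁` (line `L₀`), `P₂` (surface `S₁`), `P₃` (line `L₁″`), `P₄` (surface `S₂`).  On the charts of
`x₀` and `x₁` of `Bl_𝔪` only ONE of the two lines is visible and the tower there is the conic
tower of the two-quadric member (`TwoQuadric.conicTower_isRegular`, p543390) decorated by the
(harmless) transforms of the avatars of the absent centres.  With `P = (u, p, v)` the visible
line (`u` exceptional, `p = x₃/x_i`, `v` the host), `K = (v) + (p²) + (u²)` the member,
`D = (p, u)`:

* chart of `x₀` (`L₀` absent: `P₁ ↦ unit`): residual `K · P · ((v) + P²)`; THIS FILE supplies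
  `host_sup_centre_sq` (`(v) + P² = (v) + (p², u p, u²) = J` of the conic tower) and
  `reduce_top` (removal of the unit factors);
* chart of `x₁` (`L₁` absent: `P₁ ↦ u · P`, `P₃ ↦ u³ · ((v) + P·D)`): residual
  `K · ((v) + P²) · ((v) + P·D) · ((v)·P² + ((v) + P·D)²) · P`, and THIS FILE proves
  `CrossingLines.conicTowerPlus_isRegular` — **every blowing up of a regular ring along that
  product is regular** (`P` quasi-regular with regular quotient): `Bl_P`, then on the `u`- and
  `p`-charts `g⁵ · N⁵` with `N = (v′, g)` the surface `S₁` (`isRegular_of_isBlowup_pair_pow`,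
  part 3a), on the `v`-chart Cartier;
* `centre_eq_of_sub_mem` — on the chart of `x₁` the avatar `(e₀, e₃, u)` of `L₀` IS the conic
  centre `(u, e₃, v)`, `v = e₀ + e₂e₃`.

Any regular ring; fact-free; nothing here is a statement of the manuscript under review
(AI-written; AI review weaker than expert review).

## References

* Q. Liu, *Algebraic Geometry and Arithmetic Curves*, OUP 2002, Thm. 8.1.19 (a). [Liu2002]
* The Stacks Project, Tags 080A, 080B, 0804, 0BIQ. [StacksProject]
* U. Görtz, T. Wedhorn, *Algebraic Geometry I* (2nd ed., 2020), Prop. 13.91 (2). [GortzWedhorn2020]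
-/

-- `Summit.<Summit>.<Sub>.Theorems` with `Sub = Summit` (single-conjunct summit, D-0017)
set_option linter.dupNamespace false

noncomputable section

open CategoryTheory CategoryTheory.Limits AlgebraicGeometry Literature.AlgebraicGeometry.Resolution
open scoped Pointwise nonZeroDivisors

namespace Summit.ResolutionOfSingularities.ResolutionOfSingularities.Theorems

universe u

namespace CrossingLines

open CuspMember TwoQuadric

/-! ## Ideal algebra (any commutative ring) -/

section Algebra

variable {A : Type u} [CommRing A]

/-- **`(v) + P² = J`**: for `P = (u, p, v)`, `(v) + P² = (v) + (p²) + (u p) + (u²)` — the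
avatar of the surface `S₂` of the conic tower is «host plus centre squared». [folklore] -/
theorem host_sup_centre_sq (u p v : A) :
    Ideal.span {v} ⊔ (Ideal.span {u} ⊔ Ideal.span {p} ⊔ Ideal.span {v}) ^ 2 =
      Ideal.span {v} ⊔ Ideal.span {p ^ 2} ⊔ Ideal.span {u * p} ⊔ Ideal.span {u ^ 2} := by
  rw [sup_sq, sup_sq, Ideal.span_singleton_pow, Ideal.span_singleton_pow, Ideal.span_singleton_pow,
    Ideal.span_singleton_mul_span_singleton]
  have h1 : (Ideal.span {u} ⊔ Ideal.span {p}) * Ideal.span {v} ≤ Ideal.span {v} := Ideal.mul_le_left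
  have h2 : Ideal.span {v ^ 2} ≤ Ideal.span {v} := Ideal.span_singleton_le_span_singleton.mpr ⟨v, sq v⟩
  apply le_antisymm
  · refine sup_le (le_sup_of_le_left (le_sup_of_le_left le_sup_left)) (sup_le (sup_le ?_ ?_) ?_)
    · exact sup_le (sup_le le_sup_right (le_sup_of_le_left le_sup_right))
        (le_sup_of_le_left (le_sup_of_le_left le_sup_right))
    · exact h1.trans (le_sup_of_le_left (le_sup_of_le_left le_sup_left))
    · exact h2.trans (le_sup_of_le_left (le_sup_of_le_left le_sup_left))
  · refine sup_le (sup_le (sup_le le_sup_left ?_) ?_) ?_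
    · exact le_sup_of_le_right (le_sup_of_le_left (le_sup_of_le_left le_sup_right))
    · exact le_sup_of_le_right (le_sup_of_le_left (le_sup_of_le_left (le_sup_of_le_left le_sup_right)))
    · exact le_sup_of_le_right (le_sup_of_le_left (le_sup_of_le_left (le_sup_of_le_left le_sup_left)))

/-- `⊤² = ⊤`. [folklore] -/
theorem top_sq : (⊤ : Ideal A) ^ 2 = ⊤ := by
  rw [sq, Ideal.top_mul]

/-- **Chart of `x₀`**: with the avatar of `L₀` a unit, the residual
`(K · ((w) + ⊤²) · ((w) + ⊤·D) · ((w)·⊤² + ((w) + ⊤·D)²)) · ⊤` is `(K · ((w) + P²)) · P`,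
`P = (w) + D`. [folklore] -/
theorem reduce_top (K D : Ideal A) (w : A) :
    K * (Ideal.span {w} ⊔ ⊤ ^ 2) * (Ideal.span {w} ⊔ ⊤ * D) *
      (Ideal.span {w} * ⊤ ^ 2 ⊔ (Ideal.span {w} ⊔ ⊤ * D) ^ 2) * ⊤ =
      (K * (Ideal.span {w} ⊔ (Ideal.span {w} ⊔ D) ^ 2)) * (Ideal.span {w} ⊔ D) := by
  rw [top_sq, Ideal.top_mul, Ideal.mul_top, Ideal.mul_top, sup_top_eq, Ideal.mul_top, mul_right_comm]

/-- `(w) + ((p) + (u))` reordered to the conic centre `(u) + (p) + (w)`. [folklore] -/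
theorem span_sup_pair_eq (u p w : A) :
    Ideal.span {w} ⊔ (Ideal.span {p} ⊔ Ideal.span {u}) = Ideal.span {u} ⊔ Ideal.span {p} ⊔ Ideal.span {w} := by
  ac_rfl

/-- **Chart of `x₁`**: the avatar `(a) + (p) + (u)` of `L₀` is the conic centre `(u) + (p) + (v)`
when `v - a ∈ (p)` (`v = e₀ + e₂e₃`, `a = e₀`, `p = e₃`). [folklore] -/
theorem centre_eq_of_sub_mem (u p v a : A) (h : a - v ∈ Ideal.span {p}) :
    Ideal.span {a} ⊔ Ideal.span {p} ⊔ Ideal.span {u} = Ideal.span {u} ⊔ Ideal.span {p} ⊔ Ideal.span {v} := by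
  rw [sup_comm (Ideal.span {a}), sup_span_congr_of_sub_mem (Ideal.span {p}) h]
  ac_rfl

/-- **`p`-chart of `Bl_P`** (`p = g`, `u = g u′`, `v = g v′`): `(v) + P·D ↦ g · N`. [folklore] -/
theorem pChart_A (g w c : A) :
    Ideal.span {g * w} ⊔ Ideal.span {g} * (Ideal.span {g} ⊔ Ideal.span {g * c}) =
      Ideal.span {g} * (Ideal.span {w} ⊔ Ideal.span {g}) := by
  rw [sup_comm (Ideal.span {g}) (Ideal.span {g * c})]
  exact uChart_A g w c

/-- Images of `(v) + P·D` and of `(v)·P² + A²` under a ring map with `P ↦ (g)`. [folklore] -/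
theorem map_plus {C : Type u} [CommRing C] (φ : A →+* C) (v p u : A) (P : Ideal A) (g : C)
    (hP : P.map φ = Ideal.span {g}) :
    (Ideal.span {v} ⊔ P ^ 2).map φ = Ideal.span {φ v} ⊔ Ideal.span {g} ^ 2 ∧
    (Ideal.span {v} ⊔ P * (Ideal.span {p} ⊔ Ideal.span {u})).map φ =
      Ideal.span {φ v} ⊔ Ideal.span {g} * (Ideal.span {φ p} ⊔ Ideal.span {φ u}) ∧
    (Ideal.span {v} * P ^ 2 ⊔ (Ideal.span {v} ⊔ P * (Ideal.span {p} ⊔ Ideal.span {u})) ^ 2).map φ =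
      Ideal.span {φ v} * Ideal.span {g} ^ 2 ⊔
        (Ideal.span {φ v} ⊔ Ideal.span {g} * (Ideal.span {φ p} ⊔ Ideal.span {φ u})) ^ 2 :=
  ⟨map_J φ v P g hP, map_A φ v u p P g hP, map_T φ v u p P g hP⟩

end Algebra

/-! ## The conic tower with the avatars of the absent centres (chart of `x₁`) -/

section Tower

variable {A : Type u} [CommRing A] [IsRegularRing A] (u p v : A)

/-- The centre `P = (u, p, v)` as a family. -/
local notation3 "xx" => (![u, p, v] : Fin 3 → A)
/-- The residual of the member: `K = (v) + (p²) + (u²)`. -/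
local notation3 "KK" => (Ideal.span {v} ⊔ Ideal.span {p ^ 2} ⊔ Ideal.span {u ^ 2})
/-- The centre `P = (u) + (p) + (v)`. -/
local notation3 "PP" => (Ideal.span {u} ⊔ Ideal.span {p} ⊔ Ideal.span {v})
/-- `D = (p) + (u)`. -/
local notation3 "DD" => (Ideal.span {p} ⊔ Ideal.span {u})

set_option maxHeartbeats 400000 in
-- `pow_mem` vs the statement-level `g ^ 5`: instance-path defeq through `HomogeneousLocalization` (as in p508825)
/-- **THE CONIC TOWER WITH THE AVATARS OF THE ABSENT CENTRES (ring level).** For every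
regular ring `A` and `u, p, v ∈ A` with `(u, p, v)` quasi-regular and `A/(u, p, v)` regular,
every blowing up of `Spec A` along
`(K · ((v) + P²) · ((v) + P·D) · ((v)·P² + ((v) + P·D)²)) · P`, `P = (u, p, v)`, `D = (p, u)`,
`K = (v) + (p²) + (u²)`, is a regular scheme: `Bl_P` (regular centre), on its `u`- and
`p`-charts the four factors are `g⁵ · N⁵` with `N = (v′, g)` quasi-regular with regular quotient
(`isRegular_of_isBlowup_pair_pow`), on its `v`-chart they are Cartier.
[cite: Liu2002, Thm. 8.1.19 (a)] [cite: StacksProject, Tag 080A] [cite: StacksProject, Tag 0BIQ] -/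
theorem conicTowerPlus_isRegular (hq : IsQuasiRegular xx)
    (hreg : IsRegularRing (A ⧸ (Ideal.span {u} ⊔ Ideal.span {p} ⊔ Ideal.span {v})))
    {Y : Scheme.{u}} {f : Y ⟶ Spec (.of A)}
    (hf : IsBlowup f (affineBlowup.idealSheaf
      ((KK * (Ideal.span {v} ⊔ PP ^ 2) * (Ideal.span {v} ⊔ PP * DD) *
        (Ideal.span {v} * PP ^ 2 ⊔ (Ideal.span {v} ⊔ PP * DD) ^ 2)) * PP))) :
    Scheme.IsRegular Y := by
  rw [← span_range_vec3 u p v] at hf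
  haveI hAx : IsRegularRing (A ⧸ Ideal.span (Set.range xx)) := by
    rw [span_range_vec3 u p v]; exact hreg
  refine isRegular_of_isBlowup_mul_of_charts xx _ (fun j Y' ρ hρ => ?_) hf
  haveI hB : IsRegularRing (chartRing xx j) := isRegularRing_blowupChart xx j hq
  have cM : (Ideal.span (Set.range xx)).map (chartBase xx j) = Ideal.span {chartBase xx j (xx j)} :=
    map_reesChartBase_eq (xx j) (Ideal.mem_span_range_self (f := xx) (x := j))
  have hj : j = 0 ∨ j = 1 ∨ j = 2 := by
    fin_cases j
    · exact Or.inl rfl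
    · exact Or.inr (Or.inl rfl)
    · exact Or.inr (Or.inr rfl)
  rcases hj with rfl | rfl | rfl
  · -- `u`-chart: `u = g`, `p = g p′`, `v = g v′`
    have hg : chartBase xx 0 u ∈ (chartRing xx 0)⁰ :=
      reesChartBase_mem_nonZeroDivisors (xx 0) (Ideal.mem_span_range_self (f := xx) (x := 0))
    have cM' : (Ideal.span (Set.range xx)).map (chartBase xx 0) = Ideal.span {chartBase xx 0 u} := cM
    obtain ⟨mJ, mA, mT⟩ := map_plus (chartBase xx 0) v p u _ _ cM'
    have cp : chartBase xx 0 p = chartBase xx 0 u * chartGen xx 0 1 := reesChartBase_apply_eq_mul_chartGen xx 0 1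
    have cv : chartBase xx 0 v = chartBase xx 0 u * chartGen xx 0 2 := reesChartBase_apply_eq_mul_chartGen xx 0 2
    rw [Ideal.map_mul, Ideal.map_mul, Ideal.map_mul, map_K, mJ, mA, mT, cp, cv, uChart_K (A := chartRing xx 0),
      aChart_J (A := chartRing xx 0), uChart_A (A := chartRing xx 0), aChart_T (A := chartRing xx 0),
      absorb_N (A := chartRing xx 0), collect_uChart (A := chartRing xx 0)] at hρ
    obtain ⟨hq2, hreg2⟩ := pair_hyp u p v hq 0 ⟨2, by decide⟩
    refine CoreRungTower.isRegular_of_isBlowup_span_singleton_mul (pow_mem hg 5) _ (fun Y'' ρ' hρ' => ?_) hρ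
    rw [sup_comm] at hρ'
    exact isRegular_of_isBlowup_pair_pow _ _ 4 hq2 hreg2 hρ'
  · -- `p`-chart: `p = g`, `u = g u′`, `v = g v′`
    have hg : chartBase xx 1 p ∈ (chartRing xx 1)⁰ :=
      reesChartBase_mem_nonZeroDivisors (xx 1) (Ideal.mem_span_range_self (f := xx) (x := 1))
    have cM' : (Ideal.span (Set.range xx)).map (chartBase xx 1) = Ideal.span {chartBase xx 1 p} := cM
    obtain ⟨mJ, mA, mT⟩ := map_plus (chartBase xx 1) v p u _ _ cM'
    have cu : chartBase xx 1 u = chartBase xx 1 p * chartGen xx 1 0 := reesChartBase_apply_eq_mul_chartGen xx 1 0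
    have cv : chartBase xx 1 v = chartBase xx 1 p * chartGen xx 1 2 := reesChartBase_apply_eq_mul_chartGen xx 1 2
    rw [Ideal.map_mul, Ideal.map_mul, Ideal.map_mul, map_K, mJ, mA, mT, cu, cv, pChart_K (A := chartRing xx 1),
      aChart_J (A := chartRing xx 1), pChart_A (A := chartRing xx 1), aChart_T (A := chartRing xx 1),
      absorb_N (A := chartRing xx 1), collect_uChart (A := chartRing xx 1)] at hρ
    obtain ⟨hq2, hreg2⟩ := pair_hyp u p v hq 1 ⟨2, by decide⟩
    refine CoreRungTower.isRegular_of_isBlowup_span_singleton_mul (pow_mem hg 5) _ (fun Y'' ρ' hρ' => ?_) hρ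
    rw [sup_comm] at hρ'
    exact isRegular_of_isBlowup_pair_pow _ _ 4 hq2 hreg2 hρ'
  · -- `v`-chart: `v = g`: everything is Cartier
    have hg : chartBase xx 2 v ∈ (chartRing xx 2)⁰ :=
      reesChartBase_mem_nonZeroDivisors (xx 2) (Ideal.mem_span_range_self (f := xx) (x := 2))
    have cM' : (Ideal.span (Set.range xx)).map (chartBase xx 2) = Ideal.span {chartBase xx 2 v} := cM
    obtain ⟨mJ, mA, mT⟩ := map_plus (chartBase xx 2) v p u _ _ cM'
    have cu : chartBase xx 2 u = chartBase xx 2 v * chartGen xx 2 0 := reesChartBase_apply_eq_mul_chartGen xx 2 0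
    have cp : chartBase xx 2 p = chartBase xx 2 v * chartGen xx 2 1 := reesChartBase_apply_eq_mul_chartGen xx 2 1
    rw [Ideal.map_mul, Ideal.map_mul, Ideal.map_mul, map_K, mJ, mA, mT, cu, cp, vChart_K (A := chartRing xx 2),
      wChart_J (A := chartRing xx 2), wChart_A (A := chartRing xx 2), wChart_T (A := chartRing xx 2),
      Ideal.span_singleton_mul_span_singleton, Ideal.span_singleton_mul_span_singleton,
      Ideal.span_singleton_mul_span_singleton] at hρ
    exact isRegular_of_isBlowup_span_singleton_nzd (mul_mem (mul_mem (mul_mem hg hg) hg) (pow_mem hg 2)) hρ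

end Tower

end CrossingLines

end Summit.ResolutionOfSingularities.ResolutionOfSingularities.Theorems

end
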